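import Mathlib
import HarnessLib
import Summits.ValiantsHypothesis.ValiantsHypothesis.Theorems.MonotoneRestorationOrbitRestorationQPColLocalOne
import Literature.Combinatorics.SimpleGraph.TreewidthBrambleLowerBound

/-!
# The constant-treewidth span is transpose-invariant; matrix-symmetric products of ROW-local affine forms are narrow

Route MonotoneRestoration, crux `OrbitRestorationQP` (stmt-ValiantsHypothesis-18293), SPAN-currency lane of the open
sub-rung A_∞ (`stub_sigmaPiSigmaValue`), `ΠΣ` part.  Helper (`--supports`), def-free.  The mirror of
`SuperAtoms.prod_mem_narrowSpan_of_colLocalOne_matrixSymmetric` by transposition `x_{ab} ↦ x_{ba}`: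

* `rename_swap_homPoly` — the transpose of `hom_{E,n}` is `hom_{Eᵀ,n}` (`Eᵀ = E.map Prod.swap`);
  `treewidth_patternGraph_swap_le` — the pattern graph of `Eᵀ` is that of `E` with the sides exchanged, same treewidth;
  **`rename_swap_mem_narrowSpan`** — `span_ℂ {hom_{F,n} : tw F ≤ w}` is stable under transposition (TRANSPOSE TOOL in
  span currency; cf. the orbit-currency tool `Theorems/…Transpose.lean`);
* `rename_row_rename_swap`, `rename_col_rename_swap` — transposition exchanges the row and the column renamings;
* **`prod_mem_narrowSpan_of_rowLocalOne_matrixSymmetric`** — let `f = C a · Π_i L_i ≠ 0` (`|ι| < C(n,k)` factors of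
  total degree `≤ 1`, `8 < n`, `1 ≤ k`, `4k ≤ n`) be invariant under all row and all column renamings, every factor
  fixed by the ROW renamings fixing one row.  Then `f ∈ span_ℂ {hom_{F,n} : tw F ≤ 3}` (row Vandermondes
  `Π_a Π_{b<b'} (x_{ab} − x_{ab'})`, `n` even, and their affine generalisations; any column sign characters).

Together with the column version: a matrix-symmetric `ΠΣ` polynomial is narrow as soon as ONE side is local of
support `≤ 1`; more generally (`…ColUntwistedMain.lean`) as soon as the groupings of ONE side are untwisted.  The
residue of span-A₁ is the doubly twisted type.  No registered stub is closed; the crux and VP ≠ VNP are not moved.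
[folklore; cite: DwivediPagoSeppelt2026, §8]
-/

noncomputable section

open scoped Pointwise

-- `Summit.ValiantsHypothesis.ValiantsHypothesis.…` is the tree's single-conjunct layout (Sub = Summit).
set_option linter.dupNamespace false

namespace Summit.ValiantsHypothesis.ValiantsHypothesis.Theorems

namespace SuperAtoms

open MvPolynomial Finset Equiv ProductAction
open Literature.Computability.AlgebraicComplexity (homPoly)
open Literature.Combinatorics.SimpleGraph (treewidth treewidth_le_of_hom_injective)

universe u

variable {n : ℕ}

/-! ### Transposition of homomorphism polynomials and pattern graphs -/

/-- **The transpose of `hom_{E,n}` is `hom_{Eᵀ,n}`.** [folklore] -/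
theorem rename_swap_homPoly {A B : Type} [Fintype A] [DecidableEq A] [Fintype B] [DecidableEq B]
    (E : Multiset (A × B)) (n : ℕ) :
    rename (fun P : Fin n × Fin n => (P.2, P.1)) (homPoly E n ℂ) = homPoly (E.map Prod.swap) n ℂ := by
  unfold homPoly
  rw [map_sum]
  rw [← (Equiv.prodComm (A → Fin n) (B → Fin n)).sum_comp]
  refine Finset.sum_congr rfl fun h _ => ?_
  rw [map_multiset_prod, Multiset.map_map, Multiset.map_map]
  congr 1
  refine Multiset.map_congr rfl fun e _ => ?_
  simp only [Function.comp_apply, rename_X, Prod.swap, Equiv.prodComm_apply]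

/-- **Exchanging the sides of a pattern does not increase its treewidth.** [folklore] -/
theorem treewidth_patternGraph_swap_le {A B : Type u} [Fintype A] [DecidableEq A] [Fintype B] [DecidableEq B]
    (E : Multiset (A × B)) :
    treewidth (SimpleGraph.fromRel fun u v : B ⊕ A =>
        ∃ e ∈ E.map Prod.swap, u = Sum.inl e.1 ∧ v = Sum.inr e.2) ≤
      treewidth (SimpleGraph.fromRel fun u v : A ⊕ B => ∃ e ∈ E, u = Sum.inl e.1 ∧ v = Sum.inr e.2) := by
  classical
  refine treewidth_le_of_hom_injective
    { toFun := Sum.swap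
      map_rel' := ?_ } ?_
  · intro u v huv
    rw [SimpleGraph.fromRel_adj] at huv ⊢
    obtain ⟨hne, h⟩ := huv
    refine ⟨fun h' => hne (Sum.swap_leftInverse.injective h'), ?_⟩
    rcases h with ⟨e', he', rfl, rfl⟩ | ⟨e', he', rfl, rfl⟩
    · obtain ⟨e, he, rfl⟩ := Multiset.mem_map.1 he'
      exact Or.inr ⟨e, he, rfl, rfl⟩
    · obtain ⟨e, he, rfl⟩ := Multiset.mem_map.1 he'
      exact Or.inl ⟨e, he, rfl, rfl⟩
  · exact Sum.swap_leftInverse.injective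

/-- **TRANSPOSE TOOL (span currency): the constant-treewidth span is stable under `x_{ab} ↦ x_{ba}`.** [folklore] -/
theorem rename_swap_mem_narrowSpan (n w : ℕ) {p : MvPolynomial (Fin n × Fin n) ℂ}
    (hp : p ∈ Submodule.span ℂ {p : MvPolynomial (Fin n × Fin n) ℂ |
        ∃ (a b : ℕ) (E : Multiset (Fin a × Fin b)),
          treewidth (SimpleGraph.fromRel fun u v : Fin a ⊕ Fin b =>
            ∃ e ∈ E, u = Sum.inl e.1 ∧ v = Sum.inr e.2) ≤ w ∧ p = homPoly E n ℂ}) :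
    rename (fun P : Fin n × Fin n => (P.2, P.1)) p ∈ Submodule.span ℂ {p : MvPolynomial (Fin n × Fin n) ℂ |
        ∃ (a b : ℕ) (E : Multiset (Fin a × Fin b)),
          treewidth (SimpleGraph.fromRel fun u v : Fin a ⊕ Fin b =>
            ∃ e ∈ E, u = Sum.inl e.1 ∧ v = Sum.inr e.2) ≤ w ∧ p = homPoly E n ℂ} := by
  set V := Submodule.span ℂ {p : MvPolynomial (Fin n × Fin n) ℂ |
        ∃ (a b : ℕ) (E : Multiset (Fin a × Fin b)),
          treewidth (SimpleGraph.fromRel fun u v : Fin a ⊕ Fin b =>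
            ∃ e ∈ E, u = Sum.inl e.1 ∧ v = Sum.inr e.2) ≤ w ∧ p = homPoly E n ℂ} with hV
  have hle : V ≤ V.comap (rename (fun P : Fin n × Fin n => (P.2, P.1))).toLinearMap := by
    rw [hV, Submodule.span_le]
    rintro _ ⟨a, b, E, hE, rfl⟩
    rw [SetLike.mem_coe, Submodule.mem_comap, AlgHom.toLinearMap_apply, rename_swap_homPoly]
    refine Submodule.subset_span ⟨b, a, E.map Prod.swap, ?_, rfl⟩
    exact (treewidth_patternGraph_swap_le E).trans hE
  exact hle hp

/-! ### Transposition exchanges rows and columns -/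

/-- Transposition is an involution. [folklore] -/
theorem rename_swap_rename_swap (q : MvPolynomial (Fin n × Fin n) ℂ) :
    rename (fun P : Fin n × Fin n => (P.2, P.1)) (rename (fun P : Fin n × Fin n => (P.2, P.1)) q) = q := by
  rw [rename_rename]
  have : ((fun P : Fin n × Fin n => (P.2, P.1)) ∘ fun P : Fin n × Fin n => (P.2, P.1)) = id := funext fun P => rfl
  rw [this, rename_id, AlgHom.id_apply]

/-- A row renaming of the transpose is the transpose of the column renaming. [folklore] -/
theorem rename_row_rename_swap (σ : Perm (Fin n)) (q : MvPolynomial (Fin n × Fin n) ℂ) :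
    vact (K := ℂ) rowHom σ (rename (fun P : Fin n × Fin n => (P.2, P.1)) q) =
      rename (fun P : Fin n × Fin n => (P.2, P.1)) (vact (K := ℂ) colHom σ q) := by
  rw [vact_rowHom_eq_rename, vact_colHom_eq_rename, rename_rename, rename_rename]
  rfl

/-- A column renaming of the transpose is the transpose of the row renaming. [folklore] -/
theorem rename_col_rename_swap (τ : Perm (Fin n)) (q : MvPolynomial (Fin n × Fin n) ℂ) :
    vact (K := ℂ) colHom τ (rename (fun P : Fin n × Fin n => (P.2, P.1)) q) =
      rename (fun P : Fin n × Fin n => (P.2, P.1)) (vact (K := ℂ) rowHom τ q) := by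
  rw [vact_rowHom_eq_rename, vact_colHom_eq_rename, rename_rename, rename_rename]
  rfl

/-! ### The mirror theorem -/

/-- **MATRIX-SYMMETRIC PRODUCTS OF ROW-LOCAL AFFINE FORMS HAVE POLYNOMIAL ORBITS (span currency, self-contained).**
[folklore; cite: DwivediPagoSeppelt2026, §8; DixonMortimer1996, Thm 5.2B] -/
theorem prod_mem_narrowSpan_of_rowLocalOne_matrixSymmetric {k : ℕ} (hn : 8 < n) (hk : 1 ≤ k) (h4k : 4 * k ≤ n)
    {ι : Type} [Fintype ι] (L : ι → MvPolynomial (Fin n × Fin n) ℂ) (a : ℂ)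
    (hL : ∀ i, (L i).totalDegree ≤ 1) (hcard : Fintype.card ι < n.choose k) (hf0 : C a * ∏ i, L i ≠ 0)
    (hrow : ∀ σ : Perm (Fin n), vact (K := ℂ) rowHom σ (C a * ∏ i, L i) = C a * ∏ i, L i)
    (hcol : ∀ τ : Perm (Fin n), vact (K := ℂ) colHom τ (C a * ∏ i, L i) = C a * ∏ i, L i)
    (h1 : ∀ i, ∃ p : Fin n, ∀ ρ : Perm (Fin n), ρ p = p → vact (K := ℂ) rowHom ρ (L i) = L i) :
    (C a * ∏ i, L i) ∈ Submodule.span ℂ {p : MvPolynomial (Fin n × Fin n) ℂ |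
        ∃ (a b : ℕ) (E : Multiset (Fin a × Fin b)),
          treewidth (SimpleGraph.fromRel fun u v : Fin a ⊕ Fin b =>
            ∃ e ∈ E, u = Sum.inl e.1 ∧ v = Sum.inr e.2) ≤ 3 ∧ p = homPoly E n ℂ} := by
  classical
  set t : MvPolynomial (Fin n × Fin n) ℂ →ₐ[ℂ] MvPolynomial (Fin n × Fin n) ℂ :=
    rename (fun P : Fin n × Fin n => (P.2, P.1)) with ht
  have htinj : Function.Injective t :=
    rename_injective _ (fun P Q h => Prod.ext (Prod.mk.inj h).2 (Prod.mk.inj h).1)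
  set L' : ι → MvPolynomial (Fin n × Fin n) ℂ := fun i => t (L i) with hL'
  have hf' : t (C a * ∏ i, L i) = C a * ∏ i, L' i := by
    simp only [hL', map_mul, map_prod, ht, rename_C]
  have hL'deg : ∀ i, (L' i).totalDegree ≤ 1 := fun i => (totalDegree_rename_le _ _).trans (hL i)
  have hf0' : C a * ∏ i, L' i ≠ 0 := by
    rw [← hf']
    intro h
    exact hf0 (htinj (by rw [h, map_zero]))
  have hrow' : ∀ σ : Perm (Fin n), vact (K := ℂ) rowHom σ (C a * ∏ i, L' i) = C a * ∏ i, L' i := by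
    intro σ
    rw [← hf', ht, rename_row_rename_swap, hcol σ]
  have hcol' : ∀ τ : Perm (Fin n), vact (K := ℂ) colHom τ (C a * ∏ i, L' i) = C a * ∏ i, L' i := by
    intro τ
    rw [← hf', ht, rename_col_rename_swap, hrow τ]
  have h1' : ∀ i, ∃ q : Fin n, ∀ ρ : Perm (Fin n), ρ q = q → vact (K := ℂ) colHom ρ (L' i) = L' i := by
    intro i
    obtain ⟨p, hp⟩ := h1 i
    refine ⟨p, fun ρ hρ => ?_⟩
    rw [hL']
    show vact (K := ℂ) colHom ρ (rename (fun P : Fin n × Fin n => (P.2, P.1)) (L i)) = _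
    rw [rename_col_rename_swap, hp ρ hρ]
  have h := prod_mem_narrowSpan_of_colLocalOne_matrixSymmetric hn hk h4k L' a hL'deg hcard hf0' hrow' hcol' h1'
  have hback : C a * ∏ i, L i = rename (fun P : Fin n × Fin n => (P.2, P.1)) (C a * ∏ i, L' i) := by
    rw [← hf', ht, rename_swap_rename_swap]
  rw [hback]
  exact rename_swap_mem_narrowSpan n 3 h

end SuperAtoms

end Summit.ValiantsHypothesis.ValiantsHypothesis.Theorems

end
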